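import Summits.CriticalPhenomena.PercolationContinuityZ3.Theorems.Transplant.FKConnectivityAllQPat3Defs
import Summits.CriticalPhenomena.PercolationContinuityZ3.Theorems.Transplant.FKConnectivityAllQAntipodalUpc
import HarnessLib

/-!
# Connectivity correlation inequalities for `φ_{w,q}`, every `q > 0` — THREE-MARK FUNCTIONALS: symmetrisation, domination,
# and the GLUING STEP (fibre decomposition of `tval` over a two-mark side)

Theorems file (`--supports stmt-CriticalPhenomena-4575`), census lane `prim-bschramm-census` (gen 36) of the post-continuity programme (LANE 2 bschramm, FK sub-lane);
builds on p205010 (kernel theorem, internal audit signed; external expert review pending).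
No definitions, no named facts, no sorries; standard axioms.  Stage S1 (ii)–(iii) of census g35's kernel blueprint, written
ONCE for an arbitrary one-level member table `t` and arbitrary join/correction tables (the four gluing situations and the
member `T_sym` are plugged in by `…TsymSP.lean`; `STAR` and the 𝒯₂ members can reuse it).
* `FK.lval_flip` / `FK.tval_flip` — invariance under transposing the table (the involution `γ ↦ E ∖ γ`, `FK.apExp_compl`);
  linearity (`lval_add/sub/smul`), `lval_nonneg_of_coef`, `lval_single`, `tval_mono`.
* `FK.lval_dom` — DOMINATION AFTER SYMMETRISATION: if `F + Fᵀ ≥ μ·(t + tᵀ)` (placed `k` levels up) coefficientwise, then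
  `μ · tval (w shifted by k) t ≤ lval w F` for nonnegative weights.
* `FK.fib_sum`, `FK.tval_union_eq` — the GLUING DECOMPOSITION: if `pat(γ_A ∪ γ_B) = join (class γ_A) (pat γ_B)` and
  `k(γ)+k(γᶜ)+2|V| = (k+k̄)(γ_A) + (k+k̄)(γ_B) + corr + corr'`, then
  `tval(E_A ∪ E_B) = ∑_{γ_A} lval (w shifted by (k+k̄)(γ_A)) E_B (fib t join corr a a')`.
* `FK.tval_union_nonneg` — the GLUING STEP: if for every class `(a, a')` the fibre plus the swapped-class fibre dominates after
  symmetrisation `μ_{aa'} · t` at level `k_{aa'}`, and `t ≥ 0` on the three-mark side for all nonnegative weights, then `t ≥ 0`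
  on the union (classes paired through `γ_A ↦ E_A ∖ γ_A`); `FK.tval_union_nonneg₂` — the same when both sides are two-mark
  (series at the mark), with a termwise certificate after symmetrising one side.
[cite: Grimmett2006, §3.8 (pp. 61–62)] [cite: AyyerLinussonRavichandran2025, §7 (p. 22)]
-/

noncomputable section

namespace Summit.CriticalPhenomena.PercolationContinuityZ3.Theorems

namespace FK

open SimpleGraph Literature.Probability.LatticeModels Literature.Probability.Percolation
open scoped Classical

variable {V : Type*}

section Functionals

variable {w : ℕ → ℝ} {E : Finset (Sym2 V)} {x y s : V}

/-- `lval` is invariant under transposing the table (the involution `γ ↦ E ∖ γ`). [folklore] -/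
theorem lval_flip (F : ℕ → Pat3 → Pat3 → ℤ) : lval w E x y s F = lval w E x y s (fun c P Q => F c Q P) := by
  unfold lval
  rw [sum_powerset_flip E (fun γ => ∑ c ∈ Finset.range 3,
    w (apExp E γ + c) * ((fun c P Q => F c Q P) c (pat3 γ x y s) (pat3 (E \ γ) x y s) : ℝ))]
  refine Finset.sum_congr rfl fun γ hγ => ?_
  have hγE := Finset.mem_powerset.1 hγ
  simp only [Finset.sdiff_sdiff_eq_self hγE, apExp_compl hγE]

/-- `tval` is invariant under transposing the table. [folklore] -/
theorem tval_flip (t : Pat3 → Pat3 → ℤ) : tval w E x y s t = tval w E x y s (fun P Q => t Q P) := by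
  unfold tval
  rw [sum_powerset_flip E (fun γ => w (apExp E γ) * ((fun P Q => t Q P) (pat3 γ x y s) (pat3 (E \ γ) x y s) : ℝ))]
  refine Finset.sum_congr rfl fun γ hγ => ?_
  have hγE := Finset.mem_powerset.1 hγ
  simp only [Finset.sdiff_sdiff_eq_self hγE, apExp_compl hγE]

/-- A table with nonnegative coefficients evaluates nonnegatively against nonnegative weights. [folklore] -/
theorem lval_nonneg_of_coef {F : ℕ → Pat3 → Pat3 → ℤ} (hF : ∀ c < 3, ∀ P Q, 0 ≤ F c P Q) (hw : ∀ n, 0 ≤ w n) :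
    0 ≤ lval w E x y s F := by
  unfold lval
  refine Finset.sum_nonneg fun γ _ => Finset.sum_nonneg fun c hc => mul_nonneg (hw _) ?_
  exact_mod_cast hF c (Finset.mem_range.1 hc) _ _

/-- `tval` is monotone in the table for nonnegative weights. [folklore] -/
theorem tval_mono {t t' : Pat3 → Pat3 → ℤ} (h : ∀ P Q, t P Q ≤ t' P Q) (hw : ∀ n, 0 ≤ w n) :
    tval w E x y s t ≤ tval w E x y s t' := by
  unfold tval
  refine Finset.sum_le_sum fun γ _ => mul_le_mul_of_nonneg_left ?_ (hw _)
  exact_mod_cast h _ _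

/-- Linearity of `lval`: sums. [folklore] -/
theorem lval_add (F G : ℕ → Pat3 → Pat3 → ℤ) :
    lval w E x y s (fun c P Q => F c P Q + G c P Q) = lval w E x y s F + lval w E x y s G := by
  unfold lval
  rw [← Finset.sum_add_distrib]
  refine Finset.sum_congr rfl fun γ _ => ?_
  rw [← Finset.sum_add_distrib]
  refine Finset.sum_congr rfl fun c _ => ?_
  push_cast
  ring

/-- Linearity of `lval`: differences. [folklore] -/
theorem lval_sub (F G : ℕ → Pat3 → Pat3 → ℤ) :
    lval w E x y s (fun c P Q => F c P Q - G c P Q) = lval w E x y s F - lval w E x y s G := by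
  unfold lval
  rw [← Finset.sum_sub_distrib]
  refine Finset.sum_congr rfl fun γ _ => ?_
  rw [← Finset.sum_sub_distrib]
  refine Finset.sum_congr rfl fun c _ => ?_
  push_cast
  ring

/-- Linearity of `lval`: integer multiples. [folklore] -/
theorem lval_smul (m : ℤ) (F : ℕ → Pat3 → Pat3 → ℤ) :
    lval w E x y s (fun c P Q => m * F c P Q) = m * lval w E x y s F := by
  unfold lval
  rw [Finset.mul_sum]
  refine Finset.sum_congr rfl fun γ _ => ?_
  rw [Finset.mul_sum]
  refine Finset.sum_congr rfl fun c _ => ?_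
  push_cast
  ring

/-- A one-level table placed at level `k < 3`. [folklore] -/
theorem lval_single {k : ℕ} (hk : k < 3) (t : Pat3 → Pat3 → ℤ) :
    lval w E x y s (fun c P Q => if c = k then t P Q else 0) = tval (fun n => w (n + k)) E x y s t := by
  unfold lval tval
  refine Finset.sum_congr rfl fun γ _ => ?_
  have hk' : k ∈ Finset.range 3 := Finset.mem_range.2 hk
  rw [Finset.sum_eq_single_of_mem k hk']
  · simp
  · intro c _ hc
    simp [hc]

/-- **Domination after symmetrisation**: if the transpose-symmetrised table `F + Fᵀ` dominates, coefficientwise, `μ` times the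
symmetrised one-level table `t` placed at level `k`, then `μ · tval(t, one level up by k) ≤ lval(F)` for nonnegative weights
(both sides are transposition invariant, `lval_flip`). [folklore] -/
theorem lval_dom {F : ℕ → Pat3 → Pat3 → ℤ} {t : Pat3 → Pat3 → ℤ} {μ k : ℕ} (hk : k < 3)
    (hdom : ∀ c < 3, ∀ P Q, (μ : ℤ) * ((if c = k then t P Q else 0) + (if c = k then t Q P else 0)) ≤ F c P Q + F c Q P)
    (hw : ∀ n, 0 ≤ w n) : (μ : ℝ) * tval (fun n => w (n + k)) E x y s t ≤ lval w E x y s F := by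
  set T : ℕ → Pat3 → Pat3 → ℤ := fun c P Q => if c = k then t P Q else 0 with hT
  have h1 : tval (fun n => w (n + k)) E x y s t = lval w E x y s T := (lval_single hk t).symm
  have h2 : lval w E x y s T = lval w E x y s (fun c P Q => T c Q P) := lval_flip T
  have h3 : lval w E x y s F = lval w E x y s (fun c P Q => F c Q P) := lval_flip F
  have key : 0 ≤ lval w E x y s (fun c P Q => (F c P Q + F c Q P) - (μ : ℤ) * (T c P Q + T c Q P)) := by
    refine lval_nonneg_of_coef (fun c hc P Q => ?_) hw
    have := hdom c hc P Q
    simp only [hT] at this ⊢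
    linarith
  rw [lval_sub, lval_add, lval_smul, lval_add, ← h2, ← h3] at key
  push_cast at key
  rw [h1]
  nlinarith

/-! ### Fibres of a gluing -/

/-- The inner sum over the three-mark side is the evaluation of the fibre table. [folklore] -/
theorem fib_sum {join : Bool → Pat3 → Pat3} {corr : Bool → Pat3 → ℕ} (hcorr : ∀ a P, corr a P ≤ 1)
    (w' : ℕ → ℝ) (EB : Finset (Sym2 V)) (xB yB sB : V) (t : Pat3 → Pat3 → ℤ) (a a' : Bool) :
    ∑ γ ∈ EB.powerset, w' (apExp EB γ + (corr a (pat3 γ xB yB sB) + corr a' (pat3 (EB \ γ) xB yB sB))) *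
        (t (join a (pat3 γ xB yB sB)) (join a' (pat3 (EB \ γ) xB yB sB)) : ℝ) =
      lval w' EB xB yB sB (fib t join corr a a') := by
  unfold lval fib
  refine Finset.sum_congr rfl fun γ _ => ?_
  set C := corr a (pat3 γ xB yB sB) + corr a' (pat3 (EB \ γ) xB yB sB) with hC
  have hC3 : C ∈ Finset.range 3 := by
    rw [Finset.mem_range]
    have := hcorr a (pat3 γ xB yB sB)
    have := hcorr a' (pat3 (EB \ γ) xB yB sB)
    omega
  rw [Finset.sum_eq_single_of_mem C hC3 (fun c _ hc => by rw [if_neg (Ne.symm hc), Int.cast_zero, mul_zero]), if_pos rfl]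

variable [Fintype V]

/-- **Gluing decomposition of `tval`**: if the pattern of a glued configuration is `join (class of γ_A) (pattern of γ_B)` and the
antipodal exponent adds up with the corrections `corr`, then the evaluation on the union is the sum over `γ_A` of the fibre
evaluations on the three-mark side with the weight shifted by `k(γ_A) + k(E_A ∖ γ_A)`. [folklore] -/
theorem tval_union_eq {EA EB : Finset (Sym2 V)} (hd : Disjoint EA EB) {x y s xB yB sB : V}
    (cls : Finset (Sym2 V) → Bool) (join : Bool → Pat3 → Pat3) (corr : Bool → Pat3 → ℕ)
    (hpat : ∀ γA ⊆ EA, ∀ γB ⊆ EB, pat3 (γA ∪ γB) x y s = join (cls γA) (pat3 γB xB yB sB))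
    (hexp : ∀ γA ⊆ EA, ∀ γB ⊆ EB, apExp (EA ∪ EB) (γA ∪ γB) + 2 * Fintype.card V =
      apExp EA γA + apExp EB γB + (corr (cls γA) (pat3 γB xB yB sB) + corr (cls (EA \ γA)) (pat3 (EB \ γB) xB yB sB)))
    (hcorr : ∀ a P, corr a P ≤ 1) (w : ℕ → ℝ) (t : Pat3 → Pat3 → ℤ) :
    tval (fun n => w (n + 2 * Fintype.card V)) (EA ∪ EB) x y s t =
      ∑ γA ∈ EA.powerset, lval (fun n => w (apExp EA γA + n)) EB xB yB sB (fib t join corr (cls γA) (cls (EA \ γA))) := by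
  unfold tval
  beta_reduce
  rw [sum_powerset_union_disj hd]
  refine Finset.sum_congr rfl fun γA hγA => ?_
  have hγA' := Finset.mem_powerset.1 hγA
  rw [← fib_sum hcorr]
  refine Finset.sum_congr rfl fun γB hγB => ?_
  have hγB' := Finset.mem_powerset.1 hγB
  rw [union_sdiff_union hd hγA' hγB', hpat γA hγA' γB hγB', hpat (EA \ γA) Finset.sdiff_subset (EB \ γB) Finset.sdiff_subset,
    hexp γA hγA' γB hγB', add_assoc]

/-- **Gluing step (two-mark side `A`, three-mark side `B`)**: if, for every class `(a, a')` of the two-mark side, the fibre table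
of the class plus that of the transposed class `(a', a)` dominates after symmetrisation a nonnegative multiple of the member
table `t` (placed at some level), and `t` evaluates nonnegatively on the three-mark side for all nonnegative weights, then `t`
evaluates nonnegatively on the union.  (Classes are paired through the involution `γ_A ↦ E_A ∖ γ_A`, which preserves the
exponent and swaps the class.) [folklore] -/
theorem tval_union_nonneg {EA EB : Finset (Sym2 V)} (hd : Disjoint EA EB) {x y s xB yB sB : V}
    (cls : Finset (Sym2 V) → Bool) (join : Bool → Pat3 → Pat3) (corr : Bool → Pat3 → ℕ)
    (hpat : ∀ γA ⊆ EA, ∀ γB ⊆ EB, pat3 (γA ∪ γB) x y s = join (cls γA) (pat3 γB xB yB sB))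
    (hexp : ∀ γA ⊆ EA, ∀ γB ⊆ EB, apExp (EA ∪ EB) (γA ∪ γB) + 2 * Fintype.card V =
      apExp EA γA + apExp EB γB + (corr (cls γA) (pat3 γB xB yB sB) + corr (cls (EA \ γA)) (pat3 (EB \ γB) xB yB sB)))
    (hcorr : ∀ a P, corr a P ≤ 1) (t : Pat3 → Pat3 → ℤ) (μ k : Bool → Bool → ℕ) (hk : ∀ a a', k a a' < 3)
    (hdom : ∀ a a', ∀ c < 3, ∀ P Q,
      (μ a a' : ℤ) * ((if c = k a a' then t P Q else 0) + (if c = k a a' then t Q P else 0)) ≤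
        (fib t join corr a a' c P Q + fib t join corr a' a c P Q) + (fib t join corr a a' c Q P + fib t join corr a' a c Q P))
    (ihB : ∀ w' : ℕ → ℝ, (∀ n, 0 ≤ w' n) → 0 ≤ tval w' EB xB yB sB t)
    (w : ℕ → ℝ) (hw : ∀ n, 0 ≤ w n) : 0 ≤ tval w (EA ∪ EB) x y s t := by
  set w₂ : ℕ → ℝ := fun n => w (n - 2 * Fintype.card V) with hw₂
  have hw₂' : ∀ n, 0 ≤ w₂ n := fun n => hw _
  have hrew : tval w (EA ∪ EB) x y s t = tval (fun n => w₂ (n + 2 * Fintype.card V)) (EA ∪ EB) x y s t := by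
    simp only [hw₂, Nat.add_sub_cancel]
  rw [hrew, tval_union_eq hd cls join corr hpat hexp hcorr w₂ t]
  -- pair `γ_A` with its complement
  set Φ : Finset (Sym2 V) → ℝ := fun γA =>
    lval (fun n => w₂ (apExp EA γA + n)) EB xB yB sB (fib t join corr (cls γA) (cls (EA \ γA))) with hΦ
  have hpair : ∀ γA ∈ EA.powerset, 0 ≤ Φ γA + Φ (EA \ γA) := by
    intro γA hγA
    have hγA' := Finset.mem_powerset.1 hγA
    simp only [hΦ]
    rw [Finset.sdiff_sdiff_eq_self hγA', apExp_compl hγA', ← lval_add]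
    have hwA : ∀ n, 0 ≤ w₂ (apExp EA γA + n) := fun n => hw₂' _
    have h1 := lval_dom (E := EB) (x := xB) (y := yB) (s := sB) (w := fun n => w₂ (apExp EA γA + n))
      (F := fun c P Q => fib t join corr (cls γA) (cls (EA \ γA)) c P Q + fib t join corr (cls (EA \ γA)) (cls γA) c P Q)
      (hk (cls γA) (cls (EA \ γA))) (hdom (cls γA) (cls (EA \ γA))) hwA
    have h2 : 0 ≤ tval (fun n => w₂ (apExp EA γA + (n + k (cls γA) (cls (EA \ γA))))) EB xB yB sB t :=
      ihB _ fun n => hw₂' _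
    have h3 : (0 : ℝ) ≤ (μ (cls γA) (cls (EA \ γA)) : ℝ) := Nat.cast_nonneg _
    nlinarith
  have hsum : ∑ γA ∈ EA.powerset, Φ γA + ∑ γA ∈ EA.powerset, Φ (EA \ γA) =
      2 * ∑ γA ∈ EA.powerset, Φ γA := by
    rw [← sum_powerset_flip EA Φ]; ring
  have h2 : 0 ≤ ∑ γA ∈ EA.powerset, (Φ γA + Φ (EA \ γA)) := Finset.sum_nonneg hpair
  rw [Finset.sum_add_distrib, hsum] at h2
  have : ∑ γA ∈ EA.powerset, Φ γA = ∑ γA ∈ EA.powerset,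
      lval (fun n => w₂ (apExp EA γA + n)) EB xB yB sB (fib t join corr (cls γA) (cls (EA \ γA))) := rfl
  rw [← this]
  linarith

/-- **Gluing step, both sides two-mark** (series composition AT the mark): if the pattern of the union is a function `join₂` of
the two sides' bits and the exponent is additive, and the table `t` is nonnegative after symmetrising the second side's class
(`γ₂ ↦ E₂ ∖ γ₂` preserves the exponent and swaps the bit pair), then `t` evaluates nonnegatively on the union. [folklore] -/
theorem tval_union_nonneg₂ {E₁ E₂ : Finset (Sym2 V)} (hd : Disjoint E₁ E₂) {x y s : V}
    (c₁ c₂ : Finset (Sym2 V) → Bool) (join₂ : Bool → Bool → Pat3)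
    (hpat : ∀ γ₁ ⊆ E₁, ∀ γ₂ ⊆ E₂, pat3 (γ₁ ∪ γ₂) x y s = join₂ (c₁ γ₁) (c₂ γ₂))
    (hexp : ∀ γ₁ ⊆ E₁, ∀ γ₂ ⊆ E₂, apExp (E₁ ∪ E₂) (γ₁ ∪ γ₂) + 2 * Fintype.card V = apExp E₁ γ₁ + apExp E₂ γ₂)
    (t : Pat3 → Pat3 → ℤ) (hdom : ∀ a a' b b' : Bool, 0 ≤ t (join₂ a b) (join₂ a' b') + t (join₂ a b') (join₂ a' b))
    (w : ℕ → ℝ) (hw : ∀ n, 0 ≤ w n) : 0 ≤ tval w (E₁ ∪ E₂) x y s t := by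
  set w₂ : ℕ → ℝ := fun n => w (n - 2 * Fintype.card V) with hw₂
  have hw₂' : ∀ n, 0 ≤ w₂ n := fun n => hw _
  have hrew : tval w (E₁ ∪ E₂) x y s t = tval (fun n => w₂ (n + 2 * Fintype.card V)) (E₁ ∪ E₂) x y s t := by
    simp only [hw₂, Nat.add_sub_cancel]
  rw [hrew]
  unfold tval
  beta_reduce
  rw [sum_powerset_union_disj hd]
  refine Finset.sum_nonneg fun γ₁ hγ₁ => ?_
  have hγ₁' := Finset.mem_powerset.1 hγ₁
  -- the inner sum, symmetrised over `γ₂ ↦ E₂ ∖ γ₂`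
  set Ψ : Finset (Sym2 V) → ℝ := fun γ₂ => w₂ (apExp (E₁ ∪ E₂) (γ₁ ∪ γ₂) + 2 * Fintype.card V) *
    (t (pat3 (γ₁ ∪ γ₂) x y s) (pat3 ((E₁ ∪ E₂) \ (γ₁ ∪ γ₂)) x y s) : ℝ) with hΨ
  have hpair : ∀ γ₂ ∈ E₂.powerset, 0 ≤ Ψ γ₂ + Ψ (E₂ \ γ₂) := by
    intro γ₂ hγ₂
    have hγ₂' := Finset.mem_powerset.1 hγ₂
    simp only [hΨ]
    rw [union_sdiff_union hd hγ₁' hγ₂', union_sdiff_union hd hγ₁' Finset.sdiff_subset, Finset.sdiff_sdiff_eq_self hγ₂',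
      hexp γ₁ hγ₁' γ₂ hγ₂', hexp γ₁ hγ₁' (E₂ \ γ₂) Finset.sdiff_subset, apExp_compl hγ₂',
      hpat γ₁ hγ₁' γ₂ hγ₂', hpat (E₁ \ γ₁) Finset.sdiff_subset (E₂ \ γ₂) Finset.sdiff_subset,
      hpat γ₁ hγ₁' (E₂ \ γ₂) Finset.sdiff_subset, hpat (E₁ \ γ₁) Finset.sdiff_subset γ₂ hγ₂', ← mul_add]
    refine mul_nonneg (hw₂' _) ?_
    exact_mod_cast hdom _ _ _ _
  have hsum : ∑ γ₂ ∈ E₂.powerset, Ψ γ₂ + ∑ γ₂ ∈ E₂.powerset, Ψ (E₂ \ γ₂) = 2 * ∑ γ₂ ∈ E₂.powerset, Ψ γ₂ := by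
    rw [← sum_powerset_flip E₂ Ψ]; ring
  have h2 : 0 ≤ ∑ γ₂ ∈ E₂.powerset, (Ψ γ₂ + Ψ (E₂ \ γ₂)) := Finset.sum_nonneg hpair
  rw [Finset.sum_add_distrib, hsum] at h2
  have : ∑ γ₂ ∈ E₂.powerset, Ψ γ₂ = ∑ γ₂ ∈ E₂.powerset, w₂ (apExp (E₁ ∪ E₂) (γ₁ ∪ γ₂) + 2 * Fintype.card V) *
    (t (pat3 (γ₁ ∪ γ₂) x y s) (pat3 ((E₁ ∪ E₂) \ (γ₁ ∪ γ₂)) x y s) : ℝ) := rfl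
  rw [← this]
  linarith

end Functionals

end FK

end Summit.CriticalPhenomena.PercolationContinuityZ3.Theorems

end
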